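import Literature.Computability.Cryptography.LWENoise
import HarnessLib

/-!
# Rounding through a finer grid: the reduction's discretisations are exact functions of a floor-rounded fine value

Topic `Computability/Cryptography` (family `pqc`), grouping namespace `Regev2009`. Three elementary
identities (all PROVED; no definition, no named fact) recording how a MACHINE realises, in exact
arithmetic, the discretisations `⌊M·y⌉ mod M` (`LWE.discretize M`, `⌊·⌉ = round = ⌊· + ½⌋`) of the real
number `y = ⟨x, v⟩/p + e` manufactured in Regev's classical reduction (Lemma 3.11 = Peikert 2009,
Prop. 3.2; the idealised experiment `Regev2009.regevBDD` of `RegevBDDToLWEIdealised.lean` rounds the SAME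
`y` at the two scales `M = p` and `M = pK`), when it only holds a noise sample on a grid:

* `floor_mul_add_of_mem_grid` — if `t ∈ (1/L)ℤ` then `⌊L(t + e)⌋ = L·t + ⌊L·e⌋`: sampling the INTEGER
  `⌊L·e⌋` (a floor-rounded Gaussian) and adding the exactly known grid point `t = ⟨x, v⟩/p`
  (`L` a multiple of the denominators of `⟨x, v⟩/p`) gives `⌊L·y⌋` exactly;
* `round_eq_floor_div` — for an even `N ≥ 2`, `⌊z⌉ = ⌊(⌊N·z⌋ + N/2)/N⌋` (integer division): the
  rounding at scale `M` is an exact function of the floor at the finer scale `L = M·N`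
  (`round_mul_eq_floor_div`: `⌊M·y⌉ = ⌊(⌊M·N·y⌋ + N/2)/N⌋`);
* `discretize_eq_of_floor` — hence `LWE.discretize M y` is determined by the integer `⌊M·N·y⌋`.

So with `L = p·K·N`, `N` even, the machine's coarse (`M = p`, factor `K·N`) and fine (`M = pK`,
factor `N`) samples coincide with the idealised ones draw by draw: no statistical-distance argument is
needed for the rounding, only for the sampler of the integer `⌊L·e⌋`.

## References

* O. Regev, *On lattices, learning with errors, random linear codes, and cryptography*, J. ACM 56
  (2009), art. 34, §2 (`Ψ̄ = ⌊p·⌉ mod p`) and Lemma 3.11 [RegevLWE2009].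
* C. Peikert, *Public-key cryptosystems from the worst-case shortest vector problem*, STOC 2009, full
  version p. 7 ("all the arguments can be made rigorous by using a suitable amount of precision")
  [Peikert2009].
-/

namespace Literature.Computability.Cryptography

namespace Regev2009

/-- **Grid translations commute with the floor**: if `L·t ∈ ℤ` then `⌊L(t + e)⌋ = L·t + ⌊L·e⌋`.
[folklore] -/
theorem floor_mul_add_of_mem_grid {L : ℝ} {t e : ℝ} (k : ℤ) (hk : L * t = k) :
    ⌊L * (t + e)⌋ = k + ⌊L * e⌋ := by
  rw [mul_add, hk, Int.floor_intCast_add]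

/-- **Rounding from a finer floor**: for an even `N ≥ 2` and every real `z`,
`⌊z⌉ = ⌊(⌊N·z⌋ + N/2)/N⌋` (integer division; `⌊z⌉ = ⌊z + ½⌋ = ⌊(Nz + N/2)/N⌋` and
`⌊w/N⌋ = ⌊⌊w⌋/N⌋`). [folklore] -/
theorem round_eq_floor_div {N : ℕ} (hN : 2 ∣ N) (hN0 : 0 < N) (z : ℝ) :
    round z = (⌊(N : ℝ) * z⌋ + (N / 2 : ℕ)) / (N : ℤ) := by
  obtain ⟨H, rfl⟩ := hN
  have hH : 0 < H := by omega
  rw [Nat.mul_div_cancel_left H two_pos, round_eq]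
  have h1 : z + 1 / 2 = (((2 * H : ℕ) : ℝ) * z + (H : ℕ)) / ((2 * H : ℕ) : ℝ) := by
    have hHr : (0 : ℝ) < H := Nat.cast_pos.2 hH
    push_cast
    field_simp
  rw [h1, Int.floor_div_natCast, Int.floor_add_natCast]

/-- The same at scale `M`: `⌊M·y⌉ = ⌊(⌊M·N·y⌋ + N/2)/N⌋` for even `N`. [folklore] -/
theorem round_mul_eq_floor_div (M : ℝ) {N : ℕ} (hN : 2 ∣ N) (hN0 : 0 < N) (y : ℝ) :
    round (M * y) = (⌊(M * N : ℝ) * y⌋ + (N / 2 : ℕ)) / (N : ℤ) := by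
  rw [round_eq_floor_div hN hN0, show (N : ℝ) * (M * y) = M * N * y by ring]

/-- **`LWE.discretize M y` is determined by the integer `⌊M·N·y⌋`** (even `N`): a machine holding the
floor-rounded fine value computes the coarse sample exactly. [cite: RegevLWE2009, §2 (`Ψ̄_α = ⌊p·⌉ mod p`)] -/
theorem discretize_eq_of_floor (M : ℕ) {N : ℕ} (hN : 2 ∣ N) (hN0 : 0 < N) (y : ℝ) :
    LWE.discretize M y = (((⌊((M * N : ℕ) : ℝ) * y⌋ + (N / 2 : ℕ)) / (N : ℤ) : ℤ) : ZMod M) := by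
  rw [LWE.discretize, round_mul_eq_floor_div (M : ℝ) hN hN0 y]
  push_cast
  rfl

/-- Two reals with the same fine floor have the same discretisation (even `N`). [folklore] -/
theorem discretize_eq_of_floor_eq (M : ℕ) {N : ℕ} (hN : 2 ∣ N) (hN0 : 0 < N) {y y' : ℝ}
    (h : ⌊((M * N : ℕ) : ℝ) * y⌋ = ⌊((M * N : ℕ) : ℝ) * y'⌋) :
    LWE.discretize M y = LWE.discretize M y' := by
  rw [discretize_eq_of_floor M hN hN0 y, discretize_eq_of_floor M hN hN0 y', h]

/-- **The machine's value**: with `L = M·N`, `L·t ∈ ℤ` (the grid point `t = ⟨x, v⟩/p`) and the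
integer noise sample `⌊L·e⌋`, the exactly computable number `y' = t + ⌊L·e⌋/L` has the same fine floor as
the ideal `y = t + e`, hence the same discretisation at scale `M`. [folklore] -/
theorem discretize_add_floor_div_eq (M : ℕ) {N : ℕ} (hN : 2 ∣ N) (hMN : 0 < M * N) {t e : ℝ} (k : ℤ)
    (hk : ((M * N : ℕ) : ℝ) * t = k) :
    LWE.discretize M (t + (⌊((M * N : ℕ) : ℝ) * e⌋ : ℝ) / ((M * N : ℕ) : ℝ)) = LWE.discretize M (t + e) := by
  refine discretize_eq_of_floor_eq M hN (Nat.pos_of_mul_pos_left hMN) ?_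
  have hL : (((M * N : ℕ) : ℝ)) ≠ 0 := Nat.cast_ne_zero.2 hMN.ne'
  rw [floor_mul_add_of_mem_grid k hk, floor_mul_add_of_mem_grid k hk, mul_div_cancel₀ _ hL,
    Int.floor_intCast]

end Regev2009

end Literature.Computability.Cryptography
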